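import Mathlib.Data.Matrix.Mul
import Mathlib.LinearAlgebra.Matrix.NonsingularInverse
import Mathlib.LinearAlgebra.Matrix.ZPow
import Mathlib.LinearAlgebra.Matrix.ToLin
import Mathlib.LinearAlgebra.Projectivization.Basic
import Mathlib.Analysis.SpecialFunctions.Log.Basic
import Literature.NumberTheory.Transcendental.RoySmallValueEstimatesDistortionProofs
import Literature.NumberTheory.Transcendental.RoySmallValueEstimatesDistProofs
import Literature.NumberTheory.Transcendental.RoySmallValueEstimatesClosestPointProofs
import Literature.NumberTheory.Transcendental.NesterenkoEliminationProp411Holds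
import HarnessLib

/-!
# Small value estimates at rational translates (Nguyen–Roy 2016) — proofs, XIII: the projective plane layer

Thirteenth proofs file towards `Literature.NumberTheory.Transcendental.nguyenRoy2016_thm_1` (Nguyen–Roy,
IJNT 12 (2016) = arXiv:1412.5163). Everything here is PROVED; the definitions are the concrete
objects of §2 of the paper. This is the first of the files INSTANTIATING the hypothesis bundle
`NguyenRoy.EndgameData` of `RoySmallValueEstimatesEndgameAssemblyProofs.lean` (whose theorem
`EndgameData.false_of_constraints` is the whole of §6): it provides the point-level fields
`Pt, dist, dist_nonneg, dist_le_two, dist_comm, dist_triangle, τ, τ_zero, τ_τ, c₁, dist_τ_le, γ, τ_γ`.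

* `NguyenRoy.PPt = ℙ²(ℂ)` (Mathlib's `Projectivization ℂ (Fin 3 → ℂ)`), and the projective distance
  `NguyenRoy.pdist` on it — the tree's `Nesterenko.projDist` `‖ᾱ ∧ β̄‖/(‖ᾱ‖‖β̄‖)` on
  representatives (well defined: `pdist_mk`, by scale invariance, the tree's
  `Nesterenko.projDist_smul_left` / `PhilipponMain.projDist_smul_right`); `0 ≤ pdist ≤ 2` (the tree's
  `NguyenRoy.projDist_le_two`), symmetric, and the **weak triangle
  inequality** of §2 in the form `dist(α,γ) ≤ dist(α,β) + 2 dist(β,γ)`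
  (`projDist_weak_triangle`, from the identity
  `β_k(αᵢγⱼ − αⱼγᵢ) = αᵢ(β_kγⱼ − βⱼγ_k) − αⱼ(β_kγᵢ − βᵢγ_k) + γ_k(αᵢβⱼ − αⱼβᵢ)` with `|β_k| = ‖β‖`),
  hence `pdist a c ≤ 2(pdist a b + pdist b c)` (`pdist_triangle`).
* `NguyenRoy.tauMat r s` — the matrix of `τ̲(x, y, z) = (x, y + rx, sz)`, its integer powers in
  closed form (`tauMat_zpow`: `τ̲ⁱ(x,y,z) = (x, y + irx, sⁱz)`), and the induced translations
  `NguyenRoy.tauP r hs i` of `ℙ²(ℂ)` (`Projectivization.map`), a `ℤ`-action (`tauP_zero`,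
  `tauP_tauP`); **Lemma 5**: `pdist (τⁱa) (τⁱb) ≤ e^{c₁|i|} pdist a b` with
  `c₁ = log tauConst ≥ 0` (`pdist_tauP_le`, from the tree's `projDist_mulVec_pow_le` applied to
  `τ̲` and `τ̲⁻¹`; `one_le_tauConst`).
* `NguyenRoy.gamP ξ η r s i = (1 : ξ + ir : η sⁱ)` (`i ∈ ℤ`) with `τⁱ(γ_j) = γ_{i+j}` (`tauP_gamP`).

## References

* [NguyenRoy2016] N. A. V. Nguyen, D. Roy, IJNT 12 (2016) 1273–1293 = arXiv:1412.5163, §2: the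
  points `γ_i`, the maps `τ̲`, `τ`, the distance, its weak triangle inequality, Lemma 5.
-/

noncomputable section

open Matrix Finset
open scoped NNReal
open Literature.NumberTheory.Transcendental.Nesterenko

namespace Literature.NumberTheory.Transcendental

namespace NguyenRoy

/-! ### The projective distance: symmetry, the bound `2`, weak triangle inequality -/

section projDist

variable {m : ℕ}

/-- The projective distance is symmetric. [cite: NguyenRoy2016, §2 (the distance)] -/
theorem projDist_comm (φ ψ : Fin (m + 1) → ℂ) : projDist φ ψ = projDist ψ φ := by
  unfold projDist
  rw [mul_comm ‖φ‖]
  congr 2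
  refine Finset.sup_congr rfl fun q _ => ?_
  rw [← nnnorm_neg]
  congr 1
  ring

/-- An upper bound for the projective distance from bounds on the minors: if
`|φᵢψⱼ − φⱼψᵢ| ≤ B‖φ‖‖ψ‖` for all `i < j` then `dist(φ, ψ) ≤ B`. [folklore] -/
theorem projDist_le_of_minor_le {φ ψ : Fin (m + 1) → ℂ} (hφ : φ ≠ 0) (hψ : ψ ≠ 0) {B : ℝ}
    (hB : 0 ≤ B) (h : ∀ p : SkewIdx m, ‖φ p.1.1 * ψ p.1.2 - φ p.1.2 * ψ p.1.1‖ ≤ B * (‖φ‖ * ‖ψ‖)) :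
    projDist φ ψ ≤ B := by
  have hpos : 0 < ‖φ‖ * ‖ψ‖ := mul_pos (norm_pos_iff.mpr hφ) (norm_pos_iff.mpr hψ)
  have hsup := PhilipponMain.sup_minor_le φ ψ (by positivity : 0 ≤ B * (‖φ‖ * ‖ψ‖)) h
  rw [← PhilipponMain.projDist_mul_norm_mul_norm hφ hψ] at hsup
  exact le_of_mul_le_mul_right hsup hpos

/-- **Weak triangle inequality** for the projective distance:
`dist(α, γ) ≤ dist(α, β) + 2 dist(β, γ)` (the paper: `dist(α, γ) ≤ 2dist(α, β) + dist(β, γ)`, the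
same up to symmetry). Proof: with `|β_k| = ‖β‖`,
`β_k(αᵢγⱼ − αⱼγᵢ) = αᵢ(β_kγⱼ − βⱼγ_k) − αⱼ(β_kγᵢ − βᵢγ_k) + γ_k(αᵢβⱼ − αⱼβᵢ)`.
[cite: NguyenRoy2016, §2 (weak triangle inequality)] -/
theorem projDist_weak_triangle {α β γ : Fin (m + 1) → ℂ} (hα : α ≠ 0) (hβ : β ≠ 0) (hγ : γ ≠ 0) :
    projDist α γ ≤ projDist α β + 2 * projDist β γ := by
  obtain ⟨k, hk⟩ := PhilipponMain.exists_norm_eq_norm_apply β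
  have hβpos : 0 < ‖β‖ := norm_pos_iff.mpr hβ
  refine projDist_le_of_minor_le hα hγ
    (add_nonneg (projDist_nonneg _ _) (mul_nonneg zero_le_two (projDist_nonneg _ _))) fun p => ?_
  set i := p.1.1
  set j := p.1.2
  have hid : β k * (α i * γ j - α j * γ i) =
      α i * (β k * γ j - β j * γ k) - α j * (β k * γ i - β i * γ k) +
        γ k * (α i * β j - α j * β i) := by ring
  have h1 : ‖β k * γ j - β j * γ k‖ ≤ projDist β γ * (‖β‖ * ‖γ‖) :=
    norm_minor_le_projDist_mul hβ hγ k j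
  have h2 : ‖β k * γ i - β i * γ k‖ ≤ projDist β γ * (‖β‖ * ‖γ‖) :=
    norm_minor_le_projDist_mul hβ hγ k i
  have h3 : ‖α i * β j - α j * β i‖ ≤ projDist α β * (‖α‖ * ‖β‖) :=
    norm_minor_le_projDist_mul hα hβ i j
  have hai : ‖α i‖ ≤ ‖α‖ := norm_le_pi_norm α i
  have haj : ‖α j‖ ≤ ‖α‖ := norm_le_pi_norm α j
  have hck : ‖γ k‖ ≤ ‖γ‖ := norm_le_pi_norm γ k
  have hkey : ‖β‖ * ‖α i * γ j - α j * γ i‖ ≤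
      ‖β‖ * ((projDist α β + 2 * projDist β γ) * (‖α‖ * ‖γ‖)) := by
    calc ‖β‖ * ‖α i * γ j - α j * γ i‖ = ‖β k * (α i * γ j - α j * γ i)‖ := by
          rw [norm_mul, hk]
      _ ≤ ‖α i‖ * ‖β k * γ j - β j * γ k‖ + ‖α j‖ * ‖β k * γ i - β i * γ k‖ +
            ‖γ k‖ * ‖α i * β j - α j * β i‖ := by
          rw [hid]
          refine (norm_add_le _ _).trans (add_le_add ((norm_sub_le _ _).trans (add_le_add ?_ ?_)) ?_)
          · rw [norm_mul]
          · rw [norm_mul]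
          · rw [norm_mul]
      _ ≤ ‖α‖ * (projDist β γ * (‖β‖ * ‖γ‖)) + ‖α‖ * (projDist β γ * (‖β‖ * ‖γ‖)) +
            ‖γ‖ * (projDist α β * (‖α‖ * ‖β‖)) := by
          have p1 := projDist_nonneg β γ
          have p2 := projDist_nonneg α β
          refine add_le_add (add_le_add ?_ ?_) ?_
          · exact mul_le_mul hai h1 (norm_nonneg _) (norm_nonneg _)
          · exact mul_le_mul haj h2 (norm_nonneg _) (norm_nonneg _)
          · exact mul_le_mul hck h3 (norm_nonneg _) (norm_nonneg _)
      _ = ‖β‖ * ((projDist α β + 2 * projDist β γ) * (‖α‖ * ‖γ‖)) := by ring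
  exact le_of_mul_le_mul_left hkey hβpos

end projDist

/-! ### The points of `ℙ²(ℂ)` and the projective distance on them -/

/-- `ℂ³`. [cite: NguyenRoy2016, §2] -/
abbrev V3 : Type := Fin 3 → ℂ

/-- The projective plane `ℙ²(ℂ)`. [cite: NguyenRoy2016, §2] -/
abbrev PPt : Type := Projectivization ℂ V3

/-- The projective distance on `ℙ²(ℂ)`: `dist(α, β) = ‖ᾱ ∧ β̄‖/(‖ᾱ‖‖β̄‖)` for any representatives
(well defined by scale invariance; here through `Projectivization.rep`).
[cite: NguyenRoy2016, §2 (the distance)] -/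
def pdist (a b : PPt) : ℝ := projDist a.rep b.rep

/-- `pdist` computed on representatives. [cite: NguyenRoy2016, §2] -/
theorem pdist_mk {v w : V3} (hv : v ≠ 0) (hw : w ≠ 0) :
    pdist (Projectivization.mk ℂ v hv) (Projectivization.mk ℂ w hw) = projDist v w := by
  obtain ⟨c, hc⟩ := Projectivization.exists_smul_eq_mk_rep ℂ v hv
  obtain ⟨d, hd⟩ := Projectivization.exists_smul_eq_mk_rep ℂ w hw
  rw [pdist, ← hc, ← hd, Units.smul_def, Units.smul_def, projDist_smul_left _ c.ne_zero,
    PhilipponMain.projDist_smul_right _ d.ne_zero]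

/-- `0 ≤ pdist`. [folklore] -/
theorem pdist_nonneg (a b : PPt) : 0 ≤ pdist a b := projDist_nonneg _ _

/-- `pdist ≤ 2`. [cite: NguyenRoy2016, §2] -/
theorem pdist_le_two (a b : PPt) : pdist a b ≤ 2 := projDist_le_two _ _

/-- `pdist` is symmetric. [cite: NguyenRoy2016, §2] -/
theorem pdist_comm (a b : PPt) : pdist a b = pdist b a := projDist_comm _ _

/-- The weak triangle inequality for `pdist` (in the symmetric weakening
`dist(a, c) ≤ 2(dist(a, b) + dist(b, c))` used by `EndgameData`). [cite: NguyenRoy2016, §2] -/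
theorem pdist_triangle (a b c : PPt) : pdist a c ≤ 2 * (pdist a b + pdist b c) := by
  have h := projDist_weak_triangle a.rep_nonzero b.rep_nonzero c.rep_nonzero
  have h0 : 0 ≤ projDist a.rep b.rep := projDist_nonneg _ _
  unfold pdist
  linarith

/-! ### The translation `τ` on `ℙ²(ℂ)` -/

section tau

variable (r s : ℂ)

/-- The matrix of the linear map `τ̲(x, y, z) = (x, y + rx, sz)`.
[cite: NguyenRoy2016, §2 (the linear map τ̲)] -/
def tauMat : Matrix (Fin 3) (Fin 3) ℂ := !![1, 0, 0; r, 1, 0; 0, 0, s]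

/-- `det τ̲ = s`. [folklore] -/
theorem det_tauMat : (tauMat r s).det = s := by
  simp [tauMat, Matrix.det_fin_three]

/-- `τ̲` is invertible for `s ≠ 0`. [folklore] -/
theorem isUnit_det_tauMat {s : ℂ} (hs : s ≠ 0) : IsUnit (tauMat r s).det := by
  rw [det_tauMat]; exact isUnit_iff_ne_zero.mpr hs

/-- Closed form of the powers of `τ̲`: `τ̲ⁱ(x, y, z) = (x, y + irx, sⁱz)`. [cite: NguyenRoy2016, §2] -/
def tauMatPow (i : ℤ) : Matrix (Fin 3) (Fin 3) ℂ := !![1, 0, 0; i * r, 1, 0; 0, 0, s ^ i]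

/-- `tauMatPow 0 = 1`. [folklore] -/
theorem tauMatPow_zero : tauMatPow r s 0 = 1 := by
  ext i j
  fin_cases i <;> fin_cases j <;> simp [tauMatPow]

/-- `tauMatPow (i + 1) = tauMatPow i * τ̲`. [folklore] -/
theorem tauMatPow_add_one {s : ℂ} (hs : s ≠ 0) (i : ℤ) :
    tauMatPow r s (i + 1) = tauMatPow r s i * tauMat r s := by
  ext a b
  fin_cases a <;> fin_cases b <;> simp [tauMatPow, tauMat, Matrix.mul_apply, Fin.sum_univ_three,
    zpow_add_one₀ hs, add_mul]

/-- `tauMatPow (i - 1) = tauMatPow i * τ̲⁻¹` in closed form: `tauMatPow i * tauMatPow (-1) = tauMatPow (i - 1)`.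
[folklore] -/
theorem tauMatPow_mul_neg_one {s : ℂ} (hs : s ≠ 0) (i : ℤ) :
    tauMatPow r s i * tauMatPow r s (-1) = tauMatPow r s (i - 1) := by
  ext a b
  fin_cases a <;> fin_cases b <;> simp [tauMatPow, Matrix.mul_apply, Fin.sum_univ_three]
  all_goals first | ring1 | rw [zpow_sub_one₀ hs]

/-- `τ̲⁻¹ = tauMatPow (-1)`. [folklore] -/
theorem tauMat_inv {s : ℂ} (hs : s ≠ 0) : (tauMat r s)⁻¹ = tauMatPow r s (-1) := by
  refine Matrix.inv_eq_right_inv ?_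
  ext a b
  fin_cases a <;> fin_cases b <;> simp [tauMatPow, tauMat, Matrix.mul_apply, Fin.sum_univ_three, hs]

/-- `τ̲ⁱ = tauMatPow i` for every integer `i`. [cite: NguyenRoy2016, §2] -/
theorem tauMat_zpow {s : ℂ} (hs : s ≠ 0) (i : ℤ) : tauMat r s ^ i = tauMatPow r s i := by
  have hu := isUnit_det_tauMat r hs
  induction i using Int.induction_on with
  | zero => rw [zpow_zero, tauMatPow_zero]
  | succ n ih =>
      rw [Matrix.zpow_add_one hu, ih, tauMatPow_add_one r hs]
  | pred n ih =>
      rw [Matrix.zpow_sub_one hu, ih, tauMat_inv r hs, tauMatPow_mul_neg_one r hs]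

/-- `τ̲ⁱ v` in coordinates. [cite: NguyenRoy2016, §2] -/
theorem tauMatPow_mulVec (i : ℤ) (v : V3) :
    tauMatPow r s i *ᵥ v = ![v 0, i * r * v 0 + v 1, s ^ i * v 2] := by
  ext a
  fin_cases a <;> simp [tauMatPow, Matrix.mulVec, dotProduct, Fin.sum_univ_three]

variable {s}

/-- `τ̲ⁱ` is injective. [folklore] -/
theorem tauMat_zpow_mulVec_injective (hs : s ≠ 0) (i : ℤ) :
    Function.Injective (Matrix.toLin' (tauMat r s ^ i)) := by
  have hu : IsUnit (tauMat r s ^ i).det :=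
    Matrix.isUnit_det_zpow_iff.mpr (Or.inl (isUnit_det_tauMat r hs))
  intro v w h
  exact Matrix.mulVec_injective_iff_isUnit.mpr ((Matrix.isUnit_iff_isUnit_det _).mpr hu) h

/-- **The translation `τⁱ` of `ℙ²(ℂ)`** (`i ∈ ℤ`), induced by `τ̲ⁱ`; on `ℂ × ℂˣ ⊂ ℙ²` it is the
translation by `i·(r, s)`. [cite: NguyenRoy2016, §2 (the automorphism τ)] -/
def tauP (hs : s ≠ 0) (i : ℤ) : PPt → PPt :=
  Projectivization.map (Matrix.toLin' (tauMat r s ^ i)) (tauMat_zpow_mulVec_injective r hs i)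

/-- `τⁱ` on representatives. [cite: NguyenRoy2016, §2] -/
theorem tauP_mk (hs : s ≠ 0) (i : ℤ) {v : V3} (hv : v ≠ 0) :
    tauP r hs i (Projectivization.mk ℂ v hv) =
      Projectivization.mk ℂ (tauMat r s ^ i *ᵥ v)
        (fun h => hv (tauMat_zpow_mulVec_injective r hs i (by simpa using h))) := by
  rw [tauP, Projectivization.map_mk]
  rfl

/-- `τ⁰ = id`. [cite: NguyenRoy2016, §2] -/
theorem tauP_zero (hs : s ≠ 0) (a : PPt) : tauP r hs 0 a = a := by
  induction a using Projectivization.ind with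
  | h v hv =>
    rw [tauP_mk]
    congr 1
    rw [zpow_zero, Matrix.one_mulVec]

/-- `τⁱ ∘ τʲ = τ^{i+j}`. [cite: NguyenRoy2016, §2] -/
theorem tauP_tauP (hs : s ≠ 0) (i j : ℤ) (a : PPt) :
    tauP r hs i (tauP r hs j a) = tauP r hs (i + j) a := by
  induction a using Projectivization.ind with
  | h v hv =>
    rw [tauP_mk, tauP_mk, tauP_mk]
    congr 1
    rw [Matrix.mulVec_mulVec, ← Matrix.zpow_add (isUnit_det_tauMat r hs)]

/-- The distortion constant `c = (∑|τ̲_{ik}|)²(∑|τ̲⁻¹_{ik}|)²` of Lemma 5. [cite: NguyenRoy2016, Lemma 5] -/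
def tauConst (r s : ℂ) : ℝ :=
  (∑ i, ∑ k, ‖tauMat r s i k‖) ^ 2 * (∑ i, ∑ k, ‖(tauMat r s)⁻¹ i k‖) ^ 2

/-- `1 ≤ ∑|M_{ik}|` for a matrix with `M₀₀ = 1`. [folklore] -/
theorem one_le_sum_norm_of_apply_zero {M : Matrix (Fin 3) (Fin 3) ℂ} (h : M 0 0 = 1) :
    (1 : ℝ) ≤ ∑ i, ∑ k, ‖M i k‖ := by
  calc (1 : ℝ) = ‖M 0 0‖ := by rw [h, norm_one]
    _ ≤ ∑ k, ‖M 0 k‖ := Finset.single_le_sum (f := fun k => ‖M 0 k‖) (fun _ _ => norm_nonneg _)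
        (Finset.mem_univ 0)
    _ ≤ ∑ i, ∑ k, ‖M i k‖ := Finset.single_le_sum (f := fun i => ∑ k, ‖M i k‖)
        (fun _ _ => by positivity) (Finset.mem_univ 0)

/-- `1 ≤ c`. [folklore] -/
theorem one_le_tauConst (hs : s ≠ 0) : 1 ≤ tauConst r s := by
  have h1 : (1 : ℝ) ≤ ∑ i, ∑ k, ‖tauMat r s i k‖ :=
    one_le_sum_norm_of_apply_zero (by simp [tauMat])
  have h2 : (1 : ℝ) ≤ ∑ i, ∑ k, ‖(tauMat r s)⁻¹ i k‖ :=
    one_le_sum_norm_of_apply_zero (by rw [tauMat_inv r hs]; simp [tauMatPow])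
  rw [tauConst]
  nlinarith [one_le_pow₀ (n := 2) h1, one_le_pow₀ (n := 2) h2]

/-- **Lemma 5** (Nguyen–Roy 2016) on `ℙ²(ℂ)`: `dist(τⁱα, τⁱβ) ≤ e^{c₁|i|} dist(α, β)` with
`c₁ = log c ≥ 0`, `c` the distortion constant `tauConst` (from `projDist_mulVec_pow_le`, applied to
`τ̲` for `i ≥ 0` and to `τ̲⁻¹` for `i < 0`). [cite: NguyenRoy2016, Lemma 5] -/
theorem pdist_tauP_le (hs : s ≠ 0) (i : ℤ) (a b : PPt) :
    pdist (tauP r hs i a) (tauP r hs i b) ≤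
      Real.exp (Real.log (tauConst r s) * |(i : ℝ)|) * pdist a b := by
  have hu := isUnit_det_tauMat r hs
  have hc1 := one_le_tauConst r hs
  have hcpos : 0 < tauConst r s := by linarith
  induction a using Projectivization.ind with
  | h v hv =>
    induction b using Projectivization.ind with
    | h w hw =>
      rw [tauP_mk, tauP_mk, pdist_mk, pdist_mk]
      -- `c^n = exp(n log c)`
      have hexp : ∀ n : ℕ, tauConst r s ^ n = Real.exp (Real.log (tauConst r s) * n) := fun n => by
        rw [mul_comm, Real.exp_nat_mul, Real.exp_log hcpos]
      rcases Int.eq_nat_or_neg i with ⟨n, rfl | rfl⟩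
      · -- `i = n ≥ 0`
        rw [zpow_natCast]
        refine (projDist_mulVec_pow_le (tauMat r s) hu hv hw n).trans (le_of_eq ?_)
        rw [← tauConst, hexp n]
        simp
      · -- `i = -n`
        rw [Matrix.zpow_neg hu, zpow_natCast, ← Matrix.inv_pow']
        have hu' : IsUnit (tauMat r s)⁻¹.det := Matrix.isUnit_nonsing_inv_det _ hu
        refine (projDist_mulVec_pow_le (tauMat r s)⁻¹ hu' hv hw n).trans (le_of_eq ?_)
        rw [Matrix.nonsing_inv_nonsing_inv _ hu, mul_comm ((∑ i, ∑ k, ‖(tauMat r s)⁻¹ i k‖) ^ 2),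
          ← tauConst, hexp n]
        simp

end tau

/-! ### The points `γ_i` -/

section gamma

variable (ξ η r s : ℂ)

/-- The vector `γ̲_i = (1, ξ + ir, η sⁱ)` (`i ∈ ℤ`). [cite: NguyenRoy2016, §2 (the points γ_i)] -/
def gvec (i : ℤ) : V3 := ![1, ξ + i * r, η * s ^ i]

/-- `γ̲_i ≠ 0` (its first coordinate is `1`). [folklore] -/
theorem gvec_ne_zero (i : ℤ) : gvec ξ η r s i ≠ 0 := fun h => by
  have := congrFun h 0
  simp [gvec] at this

/-- The point `γ_i = (1 : ξ + ir : η sⁱ) ∈ ℙ²(ℂ)`. [cite: NguyenRoy2016, §2] -/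
def gamP (i : ℤ) : PPt := Projectivization.mk ℂ (gvec ξ η r s i) (gvec_ne_zero ξ η r s i)

variable {s}

/-- `τ̲ⁱ γ̲_j = γ̲_{i+j}`. [cite: NguyenRoy2016, §2 ("τ̲(γ̲_i) = γ̲_{i+1}")] -/
theorem tauMat_zpow_mulVec_gvec (hs : s ≠ 0) (i j : ℤ) :
    tauMat r s ^ i *ᵥ gvec ξ η r s j = gvec ξ η r s (i + j) := by
  rw [tauMat_zpow r hs, tauMatPow_mulVec]
  ext a
  fin_cases a
  · simp [gvec]
  · simp [gvec]; ring
  · simp [gvec]; rw [zpow_add₀ hs]; ring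

/-- `τⁱ(γ_j) = γ_{i+j}`. [cite: NguyenRoy2016, §2 ("τ(γ_i) = γ_{i+1}")] -/
theorem tauP_gamP (hs : s ≠ 0) (i j : ℤ) :
    tauP r hs i (gamP ξ η r s j) = gamP ξ η r s (i + j) := by
  rw [gamP, tauP_mk, gamP]
  congr 1
  exact tauMat_zpow_mulVec_gvec ξ η r hs i j

end gamma

end NguyenRoy

end Literature.NumberTheory.Transcendental

end
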